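import Summits.BirchSwinnertonDyer.BirchSwinnertonDyer.Theorems.ByReductionTypeAtTwoSupersingularFlatEulerCharRat
import Summits.BirchSwinnertonDyer.BirchSwinnertonDyer.Theorems.ThetaPartnerAtTwoSignedKatoUpToAtTwoLocalTwoSignedIntersection
import Literature.NumberTheory.EllipticCurves.IwasawaAlgebraDivisibilityProofs
import HarnessLib

/-!
# Route `ThetaPartnerAtTwo` (TP2), crux K2R0P♭ `SignedMainConjectureCMTwoRankZeroOfPubOfFlat` (stmt-BirchSwinnertonDyer-26471; derived
# node K2r0P stmt-BirchSwinnertonDyer-24945), line `rankzero` v16, stub (LDℓ)_A: clause (e) of the LOWER package — «the ♭ Coleman map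
# is onto off `2`» — DISCHARGED at `p = 2` in the K3 lineage's points model (`ι_P = Col♭` is onto `Λ` outright)

HONEST FRAMING (cell `pub/bsd-wall`, W-ALL row 1; width seat `bsd-wall-tp2-p2-w2` g3, `--supports` only). THEOREMS ONLY — no
definition, no named fact, no instance, no `sorry`; route-independent (no `Theses`/`Cruxes` import); closes no item; LOCAL algebra
on the tree's transcription of Sprung's objects at `p = 2` (any `W/ℚ` globally minimal with `GoodSS W 2`, CM or not); BSD is NOT
proved by any of this.

## Why this file (port spec `LOWER-LENGTH-SOCKET-w2g2.md` §5 clause (e); doors `…LowerOffTwoRobust` / `…LowerOffTwoRobustInvol`)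

The lower four-term road for (LDℓ)_A needs, besides the deep Poitou–Tate half and the `𝐇¹`-side comparison, the clause
(e) `ℓ_𝔭(Λ/ι_P(P)) = 0` at every height-one `𝔭 ∌ 2` — «`Col⁺ = Col♭` is onto at `𝔭`» — which the sister crux K3 (an UPPER
bound) never needs and therefore nobody had produced at `2`. In print Kobayashi's Thm. 6.2 / Sprung's Prop. 7.3 (`Col♭` onto
`Λ`) assume `p` odd: at odd `p` the level-`0` Honda point is `c_0 = (a_p − 2)c_{−1}` and `L♭(0) = −z(c_0)`. The `bsd-2adic` cell
ported the mechanism to `p = 2` on the `ℤ₂`-tower system `d` (`Tr_{n+2/n+1} d_{n+2} = −d_n`, level-`0` generation clause ON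
`d_0` itself): `SSFlatEC.exists_isColemanPair_of_trace`, `constantCoeff_flat_eq_neg_apply`, `isUnit_flat_of_not_dvd_apply`,
`flat_surjective_of_isUnit` (file `…SupersingularFlatColemanClauses`, any `p`). This file feeds that mechanism with the plus
Honda clause (GEN₀) «`E(ℚ_v) = ℤ·d_0 + 2·E(ℚ_v)`» exactly as the K3 lineage's HONDA⁺@2 supplies it
(`SignedKatoOffTwo.KummerPoint.exists_pointsPackage_two`, hypothesis `hgen0`), and concludes that in the K3 points model
`P = Hom(E(ℚ_{2,∞}·ℚ_v), ℤ₂)/Ker Col♭`, `ι_P = Col♭`, the map `ι_P` is ONTO `Λ`; hence (e) holds at EVERY prime, with room to spare.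

## What is proved (`v ∋ 2`, `W/ℚ` globally minimal, `GoodSS W 2`, any `ℤ₂`-extension `κ`, `ι = closureEmb`, local generator `g`)

* §1 `exists_towerFunctional_not_two_dvd_of_gen0` — from (GEN₀) on `d_0 ∈ E(ℚ_v)`: a functional `z₀ : E(ℚ_{2,∞}·ℚ_v) → ℤ₂` with
  `2 ∤ z₀(d_0)` (no `2`-torsion in the tower: `SignedKatoOffTwo.SignedIntersection.noTwoTorsion_localTowerPointsOfEmb_adicCompletion`; `E(ℚ_v)` is `2`-saturated
  in the tower; `E(ℚ_v) ≠ 2E(ℚ_v)`: `SSFlatEC.exists_layer_zero_functional_not_dvd`; Pontryagin separation).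
* §2 `exists_isColemanPair_flat_eq_two` — every `f ∈ Λ` is the ♭-Coleman value of some functional (levels + trace relation + (GEN₀)).
* §3 `surjective_of_isColemanPair_flat_two`, `range_eq_top_of_isColemanPair_flat_two`, `lengthAt_quotient_range_eq_zero_two` — for ANY
  `Λ`-module `P` with `ι_P : P →ₗ Λ` and `q : Hom(E(ℚ_{2,∞}·ℚ_v), ℤ₂) → P` reading Coleman values (`IsColemanPair … z Ls Lf → ι_P (q z) = Lf`,
  the presentation clause of `exists_pointsPackage_two`): `ι_P` is onto, `range ι_P = ⊤`, and **clause (e) `ℓ_𝔭(Λ/range ι_P) = 0` for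
  every prime `𝔭`**.

References: [Sprung2012] Thm. 2.2 (2′), Lemma 2.3 (p. 1487), Def. 5.9 (p. 1495), Def. 7.2, Prop. 7.3, Lemma 7.4 (p. 1500); [Kobayashi2003]
Thm. 6.2 (p. 11), Prop. 8.7, 8.12 (pp. 16–17), (8.23) (p. 18); [MilneADT2006] I Lemma 3.3.
-/

set_option autoImplicit false
-- the Theorems namespace of this sub repeats the summit name by design (D-0017 nested layout)
set_option linter.dupNamespace false

noncomputable section

open scoped Classical NumberField

open NumberField IsDedekindDomain

namespace Summit.BirchSwinnertonDyer.BirchSwinnertonDyer.Theorems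

namespace SignedLowerOffTwo.ColemanOnto

open Literature.NumberTheory.EllipticCurves Literature.NumberTheory.GaloisRepresentations
  WeierstrassCurve ZpExtension Literature.NumberTheory.EllipticCurves.Kobayashi2003
  Literature.NumberTheory.EllipticCurves.Sprung2012 Literature.NumberTheory.EllipticCurves.Sprung2017
  Literature.NumberTheory.EllipticCurves.Module Literature.NumberTheory.EllipticCurves.Rank1Residual

variable (W : WeierstrassCurve ℚ) [W.IsElliptic] [W.IsGloballyMinimal] (κ : ZpExtension ℚ 2)
  (v : HeightOneSpectrum (𝓞 ℚ))

/-! ## §1 A tower functional with `2 ∤ z₀(d_0)` from the plus Honda clause (GEN₀) -/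

/-- **A functional `z₀` on `E(ℚ_{2,∞}·ℚ_v)` with `2 ∤ z₀(d_0)`**, for `W/ℚ` globally minimal with `GoodSS W 2`, `v ∋ 2`, any
`ℤ₂`-extension `κ`, and a point `d_0 ∈ E(ℚ_v)` with the level-`0` plus Honda clause (GEN₀) «every `P ∈ E(ℚ_v)` is `a·d_0 + 2R`».
If `d_0 = 2y` in the tower then `y ∈ E(ℚ_v)` (no `2`-torsion in the tower, Sprung Lemma 2.3 at `2`; saturation
`Sprung2012.mem_localLayerPointsOfEmb_of_pow_nsmul_mem`), so `E(ℚ_v) = 2E(ℚ_v)` by (GEN₀), contradicting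
`SSFlatEC.exists_layer_zero_functional_not_dvd` (`E(ℚ_v) ≠ 2E(ℚ_v)`); hence `d_0 ∉ 2·E(ℚ_{2,∞}·ℚ_v)` and Pontryagin separation on the
`2`-torsion-free tower (`exists_addMonoidHom_padicInt_not_dvd`) gives `z₀`. [cite: Sprung2012, Lemma 2.3 (p. 1487), Lemma 7.4 and proof of Prop. 7.3 (p. 1500)]
[cite: MilneADT2006, I Lemma 3.3] -/
theorem exists_towerFunctional_not_two_dvd_of_gen0 (hss : GoodSS W 2) (hv : (2 : 𝓞 ℚ) ∈ v.asIdeal)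
    {d0 : localPoints W (v.adicCompletion ℚ)} (hd0 : d0 ∈ localLayerPoints κ (v.adicCompletion ℚ) W 0)
    (hgen0 : ∀ P ∈ localLayerPoints κ (v.adicCompletion ℚ) W 0, ∃ a : ℤ, ∃ R ∈ localLayerPoints κ (v.adicCompletion ℚ) W 0,
      P = a • d0 + 2 • R) :
    ∃ z₀ : localTowerPointsOfEmb κ (closureEmb (K := ℚ) (v.adicCompletion ℚ)) W →+ ℤ_[2],
      ¬ (2 : ℤ_[2]) ∣ z₀ ⟨d0, localLayerPointsOfEmb_le_localTowerPointsOfEmb κ _ W 0 hd0⟩ := by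
  set ι := closureEmb (K := ℚ) (v.adicCompletion ℚ) with hιdef
  have hnt : ∀ P ∈ localTowerPointsOfEmb κ ι W, 2 • P = 0 → P = 0 :=
    SignedKatoOffTwo.SignedIntersection.noTwoTorsion_localTowerPointsOfEmb_adicCompletion W hss κ v hv ι
  have hN : ∀ y : localTowerPointsOfEmb κ ι W, 2 • y = 0 → y = 0 := fun y hy ↦
    Subtype.ext (hnt _ y.2 (by rw [← AddSubgroupClass.coe_nsmul, hy]; rfl))
  have hpv : ((2 : ℕ) : 𝓞 ℚ) ∈ v.asIdeal := by exact_mod_cast hv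
  -- `d_0 ∉ 2 · E(ℚ_{2,∞}·ℚ_v)`
  have hx : ∀ y : localTowerPointsOfEmb κ ι W,
      2 ^ 1 • y ≠ ⟨d0, localLayerPointsOfEmb_le_localTowerPointsOfEmb κ ι W 0 hd0⟩ := by
    intro y hy
    rw [pow_one] at hy
    have hy' : 2 • (y : localPoints W (v.adicCompletion ℚ)) = d0 := by
      rw [← AddSubgroupClass.coe_nsmul, hy]
    -- `y ∈ E(ℚ_v)` by saturation
    have hy0 : (y : localPoints W (v.adicCompletion ℚ)) ∈ localLayerPointsOfEmb κ ι W 0 :=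
      mem_localLayerPointsOfEmb_of_pow_nsmul_mem κ ι W hnt y.2 (k := 1) (by rw [pow_one, hy']; exact hd0)
    -- hence `E(ℚ_v) = 2 E(ℚ_v)`, contradicting `E(ℚ_v) ≠ 2E(ℚ_v)`
    obtain ⟨z, x, hzx⟩ := SSFlatEC.exists_layer_zero_functional_not_dvd W 2 κ hpv ι hnt
    obtain ⟨a, R, hR, hxR⟩ := hgen0 x.1 x.2
    apply hzx
    have hx2 : (x : localPoints W (v.adicCompletion ℚ)) = 2 • (a • (y : localPoints W (v.adicCompletion ℚ)) + R) := by
      rw [hxR, ← hy', smul_add, smul_comm]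
    have hmem : a • (y : localPoints W (v.adicCompletion ℚ)) + R ∈ localLayerPointsOfEmb κ ι W 0 :=
      add_mem (AddSubgroup.zsmul_mem _ hy0 a) hR
    have hxeq : x = 2 • (⟨_, hmem⟩ : localLayerPointsOfEmb κ ι W 0) := Subtype.ext (by rw [AddSubgroupClass.coe_nsmul]; exact hx2)
    refine ⟨z ⟨_, hmem⟩, ?_⟩
    rw [hxeq, map_nsmul, nsmul_eq_mul, Nat.cast_ofNat]
  obtain ⟨z₀, hz₀⟩ := Literature.Algebra.Module.exists_addMonoidHom_padicInt_not_dvd hN hx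
  exact ⟨z₀, by rwa [pow_one] at hz₀⟩

/-! ## §2 Every `f ∈ Λ` is a ♭-Coleman value at `p = 2` -/

/-- **`Col♭` is onto `Λ` at `p = 2`, in Coleman-value form**: for `W/ℚ` globally minimal with `GoodSS W 2`, `v ∋ 2`, a `ℤ₂`-extension `κ`
with local generator `g`, and plus Honda data `d` — levels `d_n ∈ E(ℚ_n·ℚ_v)`, trace relation `Tr_{n+2/n+1} d_{n+2} = −d_n` (`a₂ = 0`),
and (GEN₀) on `d_0` — EVERY `f ∈ Λ` is `Col♭(z)` for some functional `z` (`IsColemanPair … 0 g d z Ls f`): `z₀` of §1 has unit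
♭-value (`L♭(0) = −z₀(d_0)`, `SSFlatEC.isUnit_flat_of_not_dvd_apply`), then `Λ`-linearity (`SSFlatEC.flat_surjective_of_isUnit`).
The `p = 2` counterpart of Sprung's Prop. 7.3 / Kobayashi's Thm. 6.2 (surjectivity), which print states for odd `p`.
[cite: Sprung2012, Prop. 7.3 and Def. 7.2 (p. 1500), Def. 5.9 (p. 1495), Thm. 2.2 (2′) (p. 1487)] [cite: Kobayashi2003, Thm. 6.2 (p. 11)] -/
theorem exists_isColemanPair_flat_eq_two (hss : GoodSS W 2) (hv : (2 : 𝓞 ℚ) ∈ v.asIdeal)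
    {g : Field.absoluteGaloisGroup (v.adicCompletion ℚ)}
    (hg : κ.IsTopGenerator (resGalOfEmb (closureEmb (K := ℚ) (v.adicCompletion ℚ)) g))
    {d : ℕ → localPoints W (v.adicCompletion ℚ)} (hd : ∀ m, d m ∈ localLayerPoints κ (v.adicCompletion ℚ) W m)
    (htr : ∀ m, localTrace κ (v.adicCompletion ℚ) W (m + 1) (m + 2) (d (m + 2)) = -d m)
    (hgen0 : ∀ P ∈ localLayerPoints κ (v.adicCompletion ℚ) W 0, ∃ a : ℤ, ∃ R ∈ localLayerPoints κ (v.adicCompletion ℚ) W 0,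
      P = a • d 0 + 2 • R)
    (f : IwasawaAlgebra 2) :
    ∃ (z : localTowerPointsOfEmb κ (closureEmb (K := ℚ) (v.adicCompletion ℚ)) W →+ ℤ_[2]) (Ls : IwasawaAlgebra 2),
      IsColemanPair κ (closureEmb (K := ℚ) (v.adicCompletion ℚ)) W 0 g d z Ls f := by
  obtain ⟨z₀, hz₀⟩ := exists_towerFunctional_not_two_dvd_of_gen0 W κ v hss hv (hd 0) hgen0
  have hTr : ∀ n, 1 ≤ n → localTraceOfEmb κ (closureEmb (K := ℚ) (v.adicCompletion ℚ)) W n (n + 1) (d (n + 1)) =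
      (0 : ℤ) • d n - d (n - 1) := by
    intro n hn
    obtain ⟨m, rfl⟩ := Nat.exists_eq_add_of_le' hn
    rw [zero_smul, zero_sub, Nat.add_sub_cancel]
    exact htr m
  obtain ⟨Ls₀, Lf₀, h0⟩ := SSFlatEC.exists_isColemanPair_of_trace κ (closureEmb (K := ℚ) (v.adicCompletion ℚ)) W hg
    (dvd_zero _) hd hTr z₀
  exact SSFlatEC.flat_surjective_of_isUnit hg hd h0 (SSFlatEC.isUnit_flat_of_not_dvd_apply h0 _ hz₀) f

/-! ## §3 Clause (e) in the K3 points model: `ι_P` is onto, so `ℓ_𝔭(Λ/range ι_P) = 0` at every prime -/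

/-- **`ι_P` is onto `Λ`** for ANY `Λ`-module `P` with a `Λ`-linear `ι_P : P → Λ` and a map `q : Hom(E(ℚ_{2,∞}·ℚ_v), ℤ₂) → P` reading
♭-Coleman values — `IsColemanPair … z Ls Lf → ι_P (q z) = Lf`, the presentation clause of `SignedKatoOffTwo.KummerPoint.exists_pointsPackage_two`
(`P = Hom/Ker Col♭`, `ι_P = Col♭`, `q` the projection) — under the hypotheses of §2. [cite: Sprung2012, Prop. 7.3 (p. 1500)]
[cite: Kobayashi2003, Thm. 6.2 (p. 11)] -/
theorem surjective_of_isColemanPair_flat_two (hss : GoodSS W 2) (hv : (2 : 𝓞 ℚ) ∈ v.asIdeal)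
    {g : Field.absoluteGaloisGroup (v.adicCompletion ℚ)}
    (hg : κ.IsTopGenerator (resGalOfEmb (closureEmb (K := ℚ) (v.adicCompletion ℚ)) g))
    {d : ℕ → localPoints W (v.adicCompletion ℚ)} (hd : ∀ m, d m ∈ localLayerPoints κ (v.adicCompletion ℚ) W m)
    (htr : ∀ m, localTrace κ (v.adicCompletion ℚ) W (m + 1) (m + 2) (d (m + 2)) = -d m)
    (hgen0 : ∀ P ∈ localLayerPoints κ (v.adicCompletion ℚ) W 0, ∃ a : ℤ, ∃ R ∈ localLayerPoints κ (v.adicCompletion ℚ) W 0,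
      P = a • d 0 + 2 • R)
    {P : Type*} [AddCommGroup P] [_root_.Module (IwasawaAlgebra 2) P] (ιP : P →ₗ[IwasawaAlgebra 2] IwasawaAlgebra 2)
    (q : (localTowerPointsOfEmb κ (closureEmb (K := ℚ) (v.adicCompletion ℚ)) W →+ ℤ_[2]) → P)
    (hq : ∀ z Ls Lf, IsColemanPair κ (closureEmb (K := ℚ) (v.adicCompletion ℚ)) W 0 g d z Ls Lf → ιP (q z) = Lf) :
    Function.Surjective ιP := fun f ↦ by
  obtain ⟨z, Ls, hz⟩ := exists_isColemanPair_flat_eq_two W κ v hss hv hg hd htr hgen0 f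
  exact ⟨q z, hq z Ls f hz⟩

/-- **`range ι_P = ⊤`** in the K3 points model at `p = 2` (same hypotheses). [cite: Sprung2012, Prop. 7.3 (p. 1500)] -/
theorem range_eq_top_of_isColemanPair_flat_two (hss : GoodSS W 2) (hv : (2 : 𝓞 ℚ) ∈ v.asIdeal)
    {g : Field.absoluteGaloisGroup (v.adicCompletion ℚ)}
    (hg : κ.IsTopGenerator (resGalOfEmb (closureEmb (K := ℚ) (v.adicCompletion ℚ)) g))
    {d : ℕ → localPoints W (v.adicCompletion ℚ)} (hd : ∀ m, d m ∈ localLayerPoints κ (v.adicCompletion ℚ) W m)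
    (htr : ∀ m, localTrace κ (v.adicCompletion ℚ) W (m + 1) (m + 2) (d (m + 2)) = -d m)
    (hgen0 : ∀ P ∈ localLayerPoints κ (v.adicCompletion ℚ) W 0, ∃ a : ℤ, ∃ R ∈ localLayerPoints κ (v.adicCompletion ℚ) W 0,
      P = a • d 0 + 2 • R)
    {P : Type*} [AddCommGroup P] [_root_.Module (IwasawaAlgebra 2) P] (ιP : P →ₗ[IwasawaAlgebra 2] IwasawaAlgebra 2)
    (q : (localTowerPointsOfEmb κ (closureEmb (K := ℚ) (v.adicCompletion ℚ)) W →+ ℤ_[2]) → P)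
    (hq : ∀ z Ls Lf, IsColemanPair κ (closureEmb (K := ℚ) (v.adicCompletion ℚ)) W 0 g d z Ls Lf → ιP (q z) = Lf) :
    LinearMap.range ιP = ⊤ :=
  LinearMap.range_eq_top.mpr (surjective_of_isColemanPair_flat_two W κ v hss hv hg hd htr hgen0 ιP q hq)

/-- **Clause (e) of the LOWER package, DISCHARGED at `p = 2` in the K3 points model: `ℓ_𝔭(Λ ⧸ range ι_P) = 0` for EVERY prime `𝔭`
of `Λ`** (the quotient is `0`). This is the hypothesis `lengthAt Λ (Λ ⧸ LinearMap.range ι) 𝔭' = 0` of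
`SignedLowerOffTwo.offTwoLower_of_lowerRobustPackageTwoInv` / `…_of_contragredientLocalDualPackageTwo` for the provider who takes
`P, ι_P, q` from `SignedKatoOffTwo.KummerPoint.exists_pointsPackage_two`. [cite: Sprung2012, Prop. 7.3 (p. 1500)]
[cite: Kobayashi2003, Thm. 6.2 (p. 11)] -/
theorem lengthAt_quotient_range_eq_zero_two (hss : GoodSS W 2) (hv : (2 : 𝓞 ℚ) ∈ v.asIdeal)
    {g : Field.absoluteGaloisGroup (v.adicCompletion ℚ)}
    (hg : κ.IsTopGenerator (resGalOfEmb (closureEmb (K := ℚ) (v.adicCompletion ℚ)) g))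
    {d : ℕ → localPoints W (v.adicCompletion ℚ)} (hd : ∀ m, d m ∈ localLayerPoints κ (v.adicCompletion ℚ) W m)
    (htr : ∀ m, localTrace κ (v.adicCompletion ℚ) W (m + 1) (m + 2) (d (m + 2)) = -d m)
    (hgen0 : ∀ P ∈ localLayerPoints κ (v.adicCompletion ℚ) W 0, ∃ a : ℤ, ∃ R ∈ localLayerPoints κ (v.adicCompletion ℚ) W 0,
      P = a • d 0 + 2 • R)
    {P : Type*} [AddCommGroup P] [_root_.Module (IwasawaAlgebra 2) P] (ιP : P →ₗ[IwasawaAlgebra 2] IwasawaAlgebra 2)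
    (q : (localTowerPointsOfEmb κ (closureEmb (K := ℚ) (v.adicCompletion ℚ)) W →+ ℤ_[2]) → P)
    (hq : ∀ z Ls Lf, IsColemanPair κ (closureEmb (K := ℚ) (v.adicCompletion ℚ)) W 0 g d z Ls Lf → ιP (q z) = Lf)
    (𝔭 : PrimeSpectrum (IwasawaAlgebra 2)) :
    lengthAt (IwasawaAlgebra 2) (IwasawaAlgebra 2 ⧸ LinearMap.range ιP) 𝔭 = 0 := by
  haveI : Subsingleton (IwasawaAlgebra 2 ⧸ LinearMap.range ιP) :=
    Submodule.Quotient.subsingleton_iff.mpr (range_eq_top_of_isColemanPair_flat_two W κ v hss hv hg hd htr hgen0 ιP q hq)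
  exact lengthAt_eq_zero_of_subsingleton 𝔭

end SignedLowerOffTwo.ColemanOnto

end Summit.BirchSwinnertonDyer.BirchSwinnertonDyer.Theorems

end
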